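import Literature.Geometry.Kaehler.HolomorphicChainPositiveLimit
import HarnessLib

/-!
# Supports of converging holomorphic chains

Layer `Literature/Geometry/Kaehler`; lane `lit-hodgefound`, programme «CHAIN COMPACTNESS», file F10:
the last clause of [Chirka1989, §16.1 Prop. 1], "and `|T_j| → |T|` in the sense of p.15.5" for
positive chains, i.e. (§15.5) the support of the limit is the limit set of the supports and every
compact part of it is approximated by the supports:

* `HolomorphicChain.support_toCurrent` — **`spt [T] = |T|`**: the support of the current of a
  holomorphic chain is the support of the chain (every ball centred on `|T|` has positive mass
  `Σ |k_Z| 𝓗^{2p}(Z ∩ B)`, `variation_toCurrent_ball_pos`);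
* `HolomorphicChain.image_support_subset_limitSet_of_tendsto` — `|T∞| ⊆ lim |T_j|` for ANY
  weakly converging sequence (`Current.support_subset_limitSet_of_tendsto`);
* `HolomorphicChain.eventually_subset_thickening_of_tendsto` — compact subsets of `|T∞|` lie in
  the `ε`-neighbourhoods of `|T_j|` for `j` large (again for any converging sequence);
* `HolomorphicChain.mem_image_support_of_mem_limitSet_of_mult_nonneg` — for POSITIVE chains the
  converse inclusion `lim |T_j| ⊆ |T∞|`: near a limit point the chains `T_j` have mass
  `≥ c(2p) r^{2p}` (Lelong's lower bound `unitBallVolume_mul_le_measure_inter_ball`, no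
  cancellation by positivity), which passes to the limit on the form `χ K_p`;
* `HolomorphicChain.tendsto_support_of_mult_nonneg` — the two together: `|T_j| → |T∞|` in the sense
  of §15.5 (the form of `exists_subseq_hasPureDim_limitSet`).

Theorems only; no new definitions, no named facts.

## References

* [Chirka1989] E. M. Chirka, *Complex Analytic Sets*, Kluwer 1989, §15.3 Thm., §15.5, §16.1
  Prop. 1, pp. 194–207.
* [Federer1969] H. Federer, *Geometric Measure Theory*, Springer 1969, 4.1.1, 4.1.7.
-/

noncomputable section

open scoped Manifold Topology ENNReal NNReal Distributions
open Set Filter MeasureTheory Metric Function TopologicalSpace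

namespace Literature.Geometry.Kaehler

open Literature.Geometry.GeometricMeasureTheory

-- Nested operator-norm instances on (duals of) `V [⋀^Fin n]→L[ℝ] ℝ`.
set_option maxSynthPendingDepth 2

universe u

variable {V : Type u} [NormedAddCommGroup V] [InnerProductSpace ℂ V] [FiniteDimensional ℂ V]
  [MeasurableSpace V] [BorelSpace V] {Ω : Opens V} {q : ℕ}

namespace HolomorphicChain

/-! ### The support of `[T]` is `|T|` -/

/-- **Every ball centred on `|T|` (with closure in `Ω`) has positive mass**:
`‖[T]‖(B(x, r)) = Σ_Z |k_Z| 𝓗^{2p}(Z ∩ B(x, r)) > 0` for `x ∈ |T|`. [cite: Chirka1989, §16.1, p. 206] -/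
theorem variation_toCurrent_ball_pos (T : HolomorphicChain 𝓘(ℂ, V) Ω (q + 1)) {w : Ω}
    (hw : w ∈ T.support) {r : ℝ} (hr : 0 < r) (hB : closedBall (w : V) r ⊆ (Ω : Set V)) :
    0 < T.toCurrent.variation (ball (w : V) r) := by
  classical
  haveI : LocallyCompactSpace Ω := Ω.isOpen.locallyCompactSpace
  obtain ⟨Z, hZ, hwZ⟩ := mem_support_iff.1 hw
  have hKc : IsCompact (((↑) : Ω → V) ⁻¹' closedBall (w : V) r) := by
    refine Topology.IsEmbedding.subtypeVal.isCompact_iff.2 ?_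
    rw [image_preimage_eq_inter_range, Subtype.range_coe, inter_eq_left.2 hB]
    exact isCompact_closedBall _ _
  have hfin := T.finite_inter_compact hKc
  set F : Finset (Set Ω) := hfin.toFinset with hF
  have hFmem : ∀ Z' : Set Ω, T.mult Z' ≠ 0 →
      ((((↑) : Ω → V) '' Z') ∩ closedBall (w : V) r).Nonempty → Z' ∈ F := by
    rintro Z' hZ' ⟨_, ⟨x, hx, rfl⟩, hxB⟩
    rw [hF, Set.Finite.mem_toFinset]
    exact ⟨hZ', x, hxB, hx⟩
  have hZF : Z ∈ F := hFmem Z hZ ⟨w, ⟨w, hwZ, rfl⟩, mem_closedBall_self hr.le⟩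
  rw [T.variation_toCurrent_apply measurableSet_ball, T.setLIntegral_enorm_density_eq_sum le_rfl F hFmem]
  refine lt_of_lt_of_le ?_ (Finset.single_le_sum (f := fun Z' => ENNReal.ofReal |(T.mult Z' : ℝ)| *
    (μHE[2 * (q + 1)] : Measure V) ((((↑) : Ω → V) '' Z') ∩ ball (w : V) r)) (fun _ _ => by positivity) hZF)
  refine ENNReal.mul_pos ?_ ((T.hasPureDim_of_mult_ne_zero hZ).euclideanHausdorffMeasure_image_inter_ball_pos hwZ hr).ne'
  rw [ne_eq, ENNReal.ofReal_eq_zero, not_le, abs_pos, Int.cast_ne_zero]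
  exact hZ

/-- **`spt [T] = |T|`**: the support of the current of a holomorphic `p`-chain (`p = q + 1`) is
(the image in `V` of) the support of the chain. [cite: Chirka1989, §16.1, p. 206; Federer1969, 4.1.1] -/
theorem support_toCurrent (T : HolomorphicChain 𝓘(ℂ, V) Ω (q + 1)) :
    T.toCurrent.support = ((↑) : Ω → V) '' T.support := by
  haveI : LocallyCompactSpace Ω := Ω.isOpen.locallyCompactSpace
  apply Subset.antisymm
  · intro x hx
    have hxΩ : x ∈ (Ω : Set V) := T.toCurrent.support_subset hx
    have hcl : x ∈ closure (((↑) : Ω → V) '' T.support) :=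
      closure_mono T.carrier_subset_image_support
        (support_currentOfIntegration_subset_closure _ _ _ (T.toCurrent_def ▸ hx))
    have h1 : (⟨x, hxΩ⟩ : Ω) ∈ closure T.support := by
      rw [Topology.IsEmbedding.subtypeVal.closure_eq_preimage_closure_image]
      exact hcl
    rw [T.isClosed_support.closure_eq] at h1
    exact ⟨⟨x, hxΩ⟩, h1, rfl⟩
  · rintro _ ⟨w, hw, rfl⟩
    by_contra hns
    obtain ⟨U, hU, hTU⟩ := T.toCurrent.exists_nhds_of_not_mem_support w.2 hns
    obtain ⟨R, hR, hRU⟩ := Metric.mem_nhds_iff.1 (inter_mem hU (Ω.isOpen.mem_nhds w.2))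
    set r : ℝ := R / 2 with hr
    have hr0 : 0 < r := half_pos hR
    have hrR : closedBall (w : V) r ⊆ ball (w : V) R := closedBall_subset_ball (half_lt_self hR)
    have hpos := T.variation_toCurrent_ball_pos hw hr0 (hrR.trans (hRU.trans inter_subset_right))
    have hzero : T.toCurrent.variation (ball (w : V) r) = 0 := by
      rw [T.toCurrent.variation_apply_of_isOpen isOpen_ball, Current.variationOn]
      refine le_antisymm (iSup_le fun φ => iSup_le fun _ => iSup_le fun hφ => ?_) bot_le
      rw [hTU φ (hφ.trans (ball_subset_closedBall.trans (hrR.trans (hRU.trans inter_subset_left)))),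
        ENNReal.ofReal_zero]
    exact hpos.ne' hzero

omit [FiniteDimensional ℂ V] [MeasurableSpace V] [BorelSpace V] in
/-- **The density of a positive chain is `≥ 1` on its support.** [cite: Chirka1989, §16.1, p. 206] -/
theorem one_le_multAt_of_mem_support {p : ℕ} (T : HolomorphicChain 𝓘(ℂ, V) Ω p)
    (h : ∀ Z, 0 ≤ T.mult Z) {w : Ω} (hw : w ∈ T.support) : 1 ≤ T.multAt w := by
  classical
  obtain ⟨Z, hZ, hwZ⟩ := mem_support_iff.1 hw
  have hfin := T.finite_inter_compact (isCompact_singleton (x := w))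
  have hsupp : Function.support (fun Z' : Set Ω => Z'.indicator (fun _ => T.mult Z') w) ⊆
      hfin.toFinset := by
    intro Z' hZ'
    rw [Function.mem_support] at hZ'
    rw [Finset.mem_coe, Set.Finite.mem_toFinset]
    by_cases hwZ' : w ∈ Z'
    · rw [indicator_of_mem hwZ'] at hZ'
      exact ⟨hZ', w, rfl, hwZ'⟩
    · exact absurd (indicator_of_notMem hwZ' _) hZ'
  rw [multAt, finsum_eq_sum_of_support_subset _ hsupp]
  have hZmem : Z ∈ hfin.toFinset := by
    rw [Set.Finite.mem_toFinset]
    exact ⟨hZ, w, rfl, hwZ⟩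
  refine le_trans ?_ (Finset.single_le_sum (fun Z' _ => Set.indicator_nonneg (fun _ _ => h Z') w) hZmem)
  rw [indicator_of_mem hwZ]
  have := h Z
  omega

/-- **`θ_T χ` is integrable on the carrier** for every test function `χ` (the density is Borel and
locally bounded, the carrier has locally finite measure). [cite: Chirka1989, §16.1, p. 206] -/
theorem integrableOn_density_mul (T : HolomorphicChain 𝓘(ℂ, V) Ω (q + 1)) (χ : 𝓓(Ω, ℝ)) :
    IntegrableOn (fun x => (T.density x : ℝ) * χ x) T.carrier (μHE[2 * (q + 1)] : Measure V) := by
  set μ : Measure V := μHE[2 * (q + 1)] with hμ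
  obtain ⟨M, hM⟩ := T.exists_forall_abs_density_le χ.hasCompactSupport χ.tsupport_subset
  obtain ⟨C, hC⟩ := (map_continuous χ).norm.bddAbove_range_of_hasCompactSupport
    χ.hasCompactSupport.norm
  have hfin : μ (T.carrier ∩ tsupport χ) < ⊤ :=
    T.measure_carrier_inter_lt_top χ.hasCompactSupport χ.tsupport_subset
  have hmeas : AEStronglyMeasurable (fun x => (T.density x : ℝ) * χ x) μ :=
    (((measurable_of_countable (Int.cast : ℤ → ℝ)).comp T.measurable_density).mul
      (map_continuous χ).measurable).aestronglyMeasurable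
  have h1 : IntegrableOn (fun x => (T.density x : ℝ) * χ x) (T.carrier ∩ tsupport χ) μ := by
    refine Measure.integrableOn_of_bounded (M := M * C) hfin.ne hmeas ?_
    filter_upwards [ae_restrict_mem (T.measurableSet_carrier.inter
      (isClosed_tsupport _).measurableSet)] with x hx
    rw [norm_mul, Real.norm_eq_abs]
    exact mul_le_mul (hM x hx.2) (hC (mem_range_self x)) (norm_nonneg _)
      ((abs_nonneg _).trans (hM x hx.2))
  refine h1.of_ae_sdiff_eq_zero T.measurableSet_carrier.nullMeasurableSet
    (Eventually.of_forall fun x hx => ?_)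
  rw [image_eq_zero_of_notMem_tsupport (fun h => hx.2 ⟨hx.1, h⟩), mul_zero]

/-! ### Supports along a converging sequence -/

section Convergence

variable (T : ℕ → HolomorphicChain 𝓘(ℂ, V) Ω (q + 1)) {T' : HolomorphicChain 𝓘(ℂ, V) Ω (q + 1)}

/-- **`|T∞| ⊆ lim |T_j|`**: if `[T_j] → [T∞]` weakly then every point of `|T∞|` is a limit point of
the supports `|T_j|` (weak limits do not enlarge supports). [cite: Chirka1989, §16.1 Prop. 1, p. 207] -/
theorem image_support_subset_limitSet_of_tendsto
    (hconv : ∀ ψ, Tendsto (fun j => (T j).toCurrent ψ) atTop (𝓝 (T'.toCurrent ψ))) :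
    (((↑) : Ω → V) '' T'.support) ⊆
      {x | ∀ N : ℕ, x ∈ closure (⋃ j ≥ N, (((↑) : Ω → V) '' (T j).support : Set V))} := by
  rw [← T'.support_toCurrent]
  exact Current.support_subset_limitSet_of_tendsto T hconv

/-- **Compact parts of `|T∞|` are approximated by the `|T_j|`**: for `K ⊆ |T∞|` compact and
`ε > 0`, `K` lies in the `ε`-neighbourhood of `|T_j|` for all large `j`. [cite: Chirka1989, §15.5 and §16.1 Prop. 1, p. 207] -/
theorem eventually_subset_thickening_of_tendsto
    (hconv : ∀ ψ, Tendsto (fun j => (T j).toCurrent ψ) atTop (𝓝 (T'.toCurrent ψ)))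
    {K : Set V} (hK : IsCompact K) (hKT : K ⊆ ((↑) : Ω → V) '' T'.support) {ε : ℝ} (hε : 0 < ε) :
    ∀ᶠ j in atTop, K ⊆ thickening ε (((↑) : Ω → V) '' (T j).support) := by
  by_contra h
  rw [not_eventually] at h
  obtain ⟨φ, hφ, hφK⟩ := extraction_of_frequently_atTop h
  have hx : ∀ n, ∃ x ∈ K, x ∉ thickening ε (((↑) : Ω → V) '' (T (φ n)).support) := fun n =>
    not_subset.1 (hφK n)
  choose x hxK hxth using hx
  obtain ⟨a, haK, ψ, hψ, hlim⟩ := hK.tendsto_subseq hxK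
  have haT : a ∈ T'.toCurrent.support := by rw [T'.support_toCurrent]; exact hKT haK
  -- `[T∞]` vanishes near `a`
  have hfar : ∀ᶠ n in atTop, Disjoint (ball a (ε / 2)) (((↑) : Ω → V) '' (T (φ (ψ n))).support) := by
    have h1 : ∀ᶠ n in atTop, dist (x (ψ n)) a < ε / 2 :=
      (Metric.tendsto_nhds.1 hlim) (ε / 2) (half_pos hε)
    filter_upwards [h1] with n hn
    refine Set.disjoint_left.2 fun z hz hzS => hxth (ψ n) ?_
    rw [mem_thickening_iff]
    refine ⟨z, hzS, ?_⟩
    calc dist (x (ψ n)) z ≤ dist (x (ψ n)) a + dist a z := dist_triangle _ _ _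
      _ < ε / 2 + ε / 2 := add_lt_add hn (mem_ball'.1 hz)
      _ = ε := by ring
  obtain ⟨φ₀, hφ₀, hne⟩ := haT.2 (ball a (ε / 2)) (isOpen_ball.mem_nhds (mem_ball_self (half_pos hε)))
  refine hne (tendsto_nhds_unique_of_eventuallyEq
    ((hconv φ₀).comp ((hφ.comp hψ).tendsto_atTop)) tendsto_const_nhds ?_)
  filter_upwards [hfar] with n hn
  show (T (φ (ψ n))).toCurrent φ₀ = 0
  refine (T (φ (ψ n))).toCurrent.apply_eq_zero_of_disjoint_support ?_
  rw [(T (φ (ψ n))).support_toCurrent]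
  exact hn.mono_left hφ₀

/-- **For positive chains, `lim |T_j| ⊆ |T∞|`**: if the `T_j` are positive `p`-chains
(`p = q + 1`) with `[T_j] → [T∞]` weakly, then every point of `Ω` that is a limit point of the
supports `|T_j|` lies on `|T∞|` — near such a point infinitely many `T_j` have mass
`≥ c(2p) r^{2p}` by Lelong's lower bound and positivity, and this mass survives in the limit of
`[T_j](χ K_p)`. [cite: Chirka1989, §16.1 Prop. 1, p. 207; §15.3 Thm., p. 194] -/
theorem mem_image_support_of_mem_limitSet_of_mult_nonneg (hpos : ∀ j Z, 0 ≤ (T j).mult Z)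
    (hconv : ∀ ψ, Tendsto (fun j => (T j).toCurrent ψ) atTop (𝓝 (T'.toCurrent ψ)))
    {x : V} (hxΩ : x ∈ (Ω : Set V))
    (hx : ∀ N : ℕ, x ∈ closure (⋃ j ≥ N, (((↑) : Ω → V) '' (T j).support : Set V))) :
    x ∈ ((↑) : Ω → V) '' T'.support := by
  haveI : FiniteDimensional ℝ V := FiniteDimensional.complexToReal V
  set μ : Measure V := μHE[2 * (q + 1)] with hμ
  rw [← T'.support_toCurrent]
  by_contra hxs
  obtain ⟨U, hU, hTU⟩ := T'.toCurrent.exists_nhds_of_not_mem_support hxΩ hxs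
  obtain ⟨R, hR, hRU⟩ := Metric.mem_nhds_iff.1 (inter_mem hU (Ω.isOpen.mem_nhds hxΩ))
  -- radii: `χ = 1` on `B̄(x, 2r)`, `spt χ = B̄(x, 3r) ⊆ U ∩ Ω`
  set r : ℝ := R / 4 with hr
  have hr0 : 0 < r := by positivity
  let β : ContDiffBump x := ⟨2 * r, 3 * r, by positivity, by linarith⟩
  have hβsupp : tsupport (β : V → ℝ) ⊆ U ∩ (Ω : Set V) := by
    rw [β.tsupport_eq]
    exact (closedBall_subset_ball (by show 3 * r < R; rw [hr]; linarith)).trans hRU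
  let χ : 𝓓(Ω, ℝ) := ⟨β, β.contDiff, β.hasCompactSupport, hβsupp.trans inter_subset_right⟩
  have hχx : ∀ y, χ y = β y := fun y => rfl
  set c : ℝ≥0∞ := unitBallVolume (2 * (q + 1)) * ENNReal.ofReal (r ^ (2 * (q + 1))) with hc
  have hc0 : c ≠ 0 := (unitBallVolume_mul_ofReal_pow_ne_zero_ne_top hr0 (q + 1)).1
  have hct : c ≠ ⊤ := (unitBallVolume_mul_ofReal_pow_ne_zero_ne_top hr0 (q + 1)).2
  have hcpos : 0 < c.toReal := ENNReal.toReal_pos hc0 hct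
  -- the lower bound `c ≤ [T_j](χ K_p)` whenever `|T_j|` meets `B(x, r)`
  have hlow : ∀ j, (((↑) : Ω → V) '' (T j).support ∩ ball x r).Nonempty →
      c.toReal ≤ (T j).toCurrent (smulCovectorCLM (kaehlerPow (q + 1)) χ) := by
    rintro j ⟨_, ⟨w, hw, rfl⟩, hwx⟩
    have hball : ball (w : V) r ⊆ closedBall x (2 * r) := fun z hz => by
      rw [mem_closedBall]
      calc dist z x ≤ dist z w + dist (w : V) x := dist_triangle _ _ _
        _ ≤ r + r := add_le_add (mem_ball.1 hz).le (mem_ball.1 hwx).le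
        _ = 2 * r := by ring
    have hballΩ : ball (w : V) r ⊆ (Ω : Set V) :=
      hball.trans ((closedBall_subset_closedBall (by linarith)).trans
        ((β.tsupport_eq ▸ hβsupp).trans inter_subset_right))
    have hcballΩ : closedBall (w : V) r ⊆ (Ω : Set V) := fun z hz =>
      (β.tsupport_eq ▸ hβsupp).trans inter_subset_right (by
        rw [mem_closedBall]
        calc dist z x ≤ dist z w + dist (w : V) x := dist_triangle _ _ _
          _ ≤ r + r := add_le_add (mem_closedBall.1 hz) (mem_ball.1 hwx).le
          _ ≤ 3 * r := by linarith)
    rw [(T j).toCurrent_smul_kaehlerPow_apply χ]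
    have hint := (T j).integrableOn_density_mul χ
    have hnn : ∀ y, 0 ≤ ((T j).density y : ℝ) * χ y := fun y =>
      mul_nonneg (by exact_mod_cast (T j).density_nonneg (hpos j) y) (β.nonneg' y)
    -- `θ ≥ 1` on the carrier, `χ = 1` on `B(w, r)`
    have hone : ∀ y ∈ (T j).carrier ∩ ball (w : V) r, (1 : ℝ) ≤ ((T j).density y : ℝ) * χ y := by
      rintro y ⟨⟨w', hw', hyw'⟩, hyb⟩
      subst hyw'
      rw [hχx, β.one_of_mem_closedBall (hball hyb), mul_one, density_apply_coe]
      exact_mod_cast (T j).one_le_multAt_of_mem_support (hpos j) (regularLocus_subset _ hw')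
    -- measure of the carrier in the ball, from Lelong's lower bound
    have hfin : μ ((T j).carrier ∩ ball (w : V) r) < ⊤ :=
      (measure_mono (inter_subset_inter_right _ ball_subset_closedBall)).trans_lt
        ((T j).measure_carrier_inter_lt_top (isCompact_closedBall _ _) hcballΩ)
    have hne : (T j).support.Nonempty := ⟨w, hw⟩
    have hmeas : c ≤ μ ((T j).carrier ∩ ball (w : V) r) := by
      have h1 := unitBallVolume_mul_le_measure_inter_ball ((T j).hasPureDim_support hne) hw hr0 hballΩ
      have hnull := (T j).euclideanHausdorffMeasure_two_mul_image_singularLocus_eq_zero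
      have hsplit : ((↑) : Ω → V) '' (T j).support ∩ ball (w : V) r ⊆
          (T j).carrier ∩ ball (w : V) r ∪ ((↑) : Ω → V) '' singularLocus 𝓘(ℂ, V) (T j).support := by
        rintro _ ⟨⟨w', hw', rfl⟩, hwb⟩
        by_cases hwr : w' ∈ regularLocus 𝓘(ℂ, V) (T j).support
        · exact Or.inl ⟨⟨w', hwr, rfl⟩, hwb⟩
        · exact Or.inr ⟨w', ⟨hw', hwr⟩, rfl⟩
      calc c ≤ μ (((↑) : Ω → V) '' (T j).support ∩ ball (w : V) r) := h1
        _ ≤ μ ((T j).carrier ∩ ball (w : V) r) +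
            μ (((↑) : Ω → V) '' singularLocus 𝓘(ℂ, V) (T j).support) :=
            (measure_mono hsplit).trans (measure_union_le _ _)
        _ = μ ((T j).carrier ∩ ball (w : V) r) := by rw [hnull, add_zero]
    calc c.toReal ≤ (μ ((T j).carrier ∩ ball (w : V) r)).toReal :=
          ENNReal.toReal_mono hfin.ne hmeas
      _ = ∫ y in (T j).carrier ∩ ball (w : V) r, (1 : ℝ) ∂μ := by
          rw [setIntegral_const, smul_eq_mul, mul_one, measureReal_def]
      _ ≤ ∫ y in (T j).carrier ∩ ball (w : V) r, ((T j).density y : ℝ) * χ y ∂μ :=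
          setIntegral_mono_on (integrableOn_const hfin.ne)
            (hint.mono_set inter_subset_left) ((T j).measurableSet_carrier.inter measurableSet_ball) hone
      _ ≤ ∫ y in (T j).carrier, ((T j).density y : ℝ) * χ y ∂μ :=
          setIntegral_mono_set hint (Eventually.of_forall hnn) (Eventually.of_forall inter_subset_left)
  -- infinitely many `|T_j|` meet `B(x, r)`
  have hfreq : ∃ᶠ j in atTop, c.toReal ≤ (T j).toCurrent (smulCovectorCLM (kaehlerPow (q + 1)) χ) := by
    refine frequently_atTop.2 fun N => ?_
    obtain ⟨z, hzb, hz⟩ := mem_closure_iff_nhds.1 (hx N) (ball x r) (isOpen_ball.mem_nhds (mem_ball_self hr0))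
    obtain ⟨j, hj⟩ := mem_iUnion.1 hz
    obtain ⟨hjN, hzj⟩ := mem_iUnion.1 hj
    exact ⟨j, hjN, hlow j ⟨z, hzj, hzb⟩⟩
  -- but `[T_j](χ K_p) → [T∞](χ K_p) = 0`
  have h0 : T'.toCurrent (smulCovectorCLM (kaehlerPow (q + 1)) χ) = 0 := by
    refine hTU _ ?_
    refine (closure_mono fun y hy => ?_).trans (hβsupp.trans inter_subset_left)
    rw [mem_support] at hy ⊢
    intro h0
    exact hy (by rw [smulCovectorCLM_apply, hχx, h0, zero_smul])
  have hlim := hconv (smulCovectorCLM (kaehlerPow (q + 1)) χ)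
  rw [h0] at hlim
  obtain ⟨j, hj1, hj2⟩ := (hfreq.and_eventually (hlim.eventually (gt_mem_nhds hcpos))).exists
  exact (lt_irrefl _) (hj1.trans_lt hj2)

/-- **`|T_j| → |T∞|` in the sense of §15.5 for positive chains** [Chirka1989, §16.1 Prop. 1, last
clause]: if the `T_j` are positive `p`-chains (`p = q + 1`) with `[T_j] → [T∞]` in the sense of
currents, then (i) the points of `|T∞|` are exactly the points of `Ω` lying in every
`cl(⋃_{j ≥ N} |T_j|)`, and (ii) every compact `K ⊆ |T∞|` lies in the `ε`-neighbourhood of `|T_j|`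
for all large `j`. [cite: Chirka1989, §16.1 Prop. 1, p. 207; §15.5, p. 203] -/
theorem tendsto_support_of_mult_nonneg (hpos : ∀ j Z, 0 ≤ (T j).mult Z)
    (hconv : ∀ ψ, Tendsto (fun j => (T j).toCurrent ψ) atTop (𝓝 (T'.toCurrent ψ))) :
    (∀ x ∈ (Ω : Set V), x ∈ ((↑) : Ω → V) '' T'.support ↔
      ∀ N : ℕ, x ∈ closure (⋃ j ≥ N, (((↑) : Ω → V) '' (T j).support : Set V))) ∧
    (∀ K : Set V, IsCompact K → K ⊆ ((↑) : Ω → V) '' T'.support → ∀ ε : ℝ, 0 < ε →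
      ∀ᶠ j in atTop, K ⊆ thickening ε (((↑) : Ω → V) '' (T j).support)) :=
  ⟨fun _ hxΩ => ⟨fun hx => image_support_subset_limitSet_of_tendsto T hconv hx,
    fun hx => mem_image_support_of_mem_limitSet_of_mult_nonneg T hpos hconv hxΩ hx⟩,
    fun _ hK hKT _ hε => eventually_subset_thickening_of_tendsto T hconv hK hKT hε⟩

end Convergence

end HolomorphicChain

end Literature.Geometry.Kaehler

end
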